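import Summits.NavierStokesRegularity.NavierStokesRegularity.Theorems.ScenarioCensusRowF1EpsilonTransfer
import Summits.NavierStokesRegularity.NavierStokesRegularity.Theorems.ScenarioCensusRowF1StretchedTransfer
import Summits.NavierStokesRegularity.NavierStokesRegularity.Theorems.ScenarioCensusRowF1InviscidTop
import HarnessLib

/-!
# LINE «epsilon-top» port, part 4/4: §5 the rows are EXCLUDED (`rowF1qd/qa/qw/ql_holds`), the floor `quantitativelyThreeDTop_holds`, displays, `vorticityDefectSlack_iff_rowF1`;
# census KEYS `Row_F1qd` / `Row_F1qa` / `Row_F1qw` / `Row_F1ql` + `_excluded`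

Re-homed for the scenario census (typer seat ns-census-typer-1 g8; the cells F1qd / F1qa / F1qw / F1ql are MEMBERS OF RECORD «DECIDED IN KERNEL IN FILES» of row F1
since census v1.69 (lead g9 RULING [6]; critic idea-crit-3 g6 PASS; ref ns-census-ref g8 PRE-CHECK ✓ §13.14; lit §21.21); this port makes them TREE-decided):
VERBATIM PORT of ns-idea-3 LINE 17 «epsilon-top», `pub/ideators/ns-idea-3/lines/epsilon-top/line-epsilon-top.lean` sha16 1627485ff09d51d4 (1185 l., lean check
rc 0, 0 sorry), split for the 400-line rule into `ScenarioCensusRowF1Epsilon` (§1–§2) → `…EpsilonLiouville` (§3) → `…EpsilonTransfer` (§4) → `…EpsilonTop` (§5 +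
census KEYS).  Lean text VERBATIM in namespace `…Theorems.ScenarioCensus.EpsilonTop` (the line's `…Cruxes.ScenarioCensusRowF1.EpsilonTopLine` re-homed); port
edits: `@[conjecture]` on the residual `VorticityDefectSlack` (≡ `ScenarioCensus.Row_F1`, OPEN), three one-line docstrings added (gate lint); the import of `Theorems.ClockStretchingLawClockCeilingFarPastVorticityFloor` and the ONE display that uses it (`liouville_qw_of_farPastVorticityFloor`, a second proof of `Liouville_qw` from the tree's far-past vorticity floor) are dropped because that module has no farm build at port time — `liouville_qw_holds` is the line's own proof and stays; the lemmas (and the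
read-out `axialDefect`) the line shares VERBATIM with the landed columnar-top / stretched-top / inviscid-top ports are taken BY NAME (listed below).
Statements untouched.

No census VALUE is moved here (row F1 stays OPEN-WITH-LINE; the members become TREE-decided by name); NS regularity is NOT proved; `Row_F1` is
untouched (zero movement, `vorticityDefectSlack_iff_rowF1`); no summit statement is proved by this file. Lemmas that restate already-landed tree declarations are taken BY NAME (gate lint `dedup.landed`): `norm_sub_inner_smul_le` = `ColumnarTop.norm_sub_inner_smul_le`, `exists_linearIsometryEquiv_map_single_one` = `ColumnarTop.exists_linearIsometryEquiv_map_single_one`, `eq_zero_of_lineInvariant` = `ColumnarTop.eq_zero_of_lineInvariant`, `isOpen_ne_zero` = `ColumnarTop.isOpen_ne_zero`, `curl_zero_field` = `StretchedTop.curl_zero_field`, `typeI_ancient_eq_zero_of_lamb_eq_zero` = `StretchedTop.typeI_ancient_eq_zero_of_lamb_eq_zero`, `lamb_smul` = `StretchedTop.lamb_smul`, `axialDefect` = `ColumnarTop.axialDefect`, `axialDefect_fderiv` = `ColumnarTop.axialDefect_fderiv`, `axialDefect_smul` = `ColumnarTop.axialDefect_smul`, `continuous_axialDefect` = `ColumnarTop.continuous_axialDefect`,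 `tendsto_physicalTime` = `ColumnarTop.tendsto_physicalTime`, `eventually_fast` = `ColumnarTop.eventually_fast`, `sqrt_timeLag` = `StretchedTop.sqrt_timeLag`, `closed_transfer` = `StretchedTop.closed_transfer`, `forall_of_forall_ne_zero` = `StretchedTop.forall_of_forall_ne_zero`, `sing_of_not_bounded` = `InviscidTop.sing_of_not_bounded`.
-/

-- the summit and its single problem share the name `NavierStokesRegularity` (D-0017 nested layout)
set_option linter.dupNamespace false

noncomputable section

open MeasureTheory Set Function Filter TopologicalSpace Metric
open scoped Topology NNReal ENNReal InnerProductSpace RealInnerProductSpace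

namespace Summit.NavierStokesRegularity.NavierStokesRegularity.Theorems.ScenarioCensus.EpsilonTop

open Literature.Analysis Literature.Analysis.FluidPDE
open Summit.NavierStokesRegularity.NavierStokesRegularity.Theorems

/-! ## §5 The rows are EXCLUDED; the floor; displays; the residual is exactly `Row_F1` -/

-- `sing_of_not_bounded`: the line restates the tree's `InviscidTop.sing_of_not_bounded`; taken BY NAME (gate lint dedup.landed).

/-- **Criterion row F1qd is EXCLUDED** (in kernel): Type I(`M`) + ε(M)-columnar top ⇒ extension. -/
theorem rowF1qd_holds : Row_F1qd := by
  intro M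
  obtain ⟨ε, hε, hLiou⟩ := liouville_qd_holds M
  refine ⟨ε, hε, fun ν T hν hT u p hsol hLH hdec hTI htop => ?_⟩
  obtain ⟨Λ, hΛ, e, he, hdef⟩ := htop
  apply hasSmoothExtensionPast_of_forall_exists_parabolicCylinder hν hT hsol hLH hdec
  intro x₀
  by_contra hno
  obtain ⟨α, β, R, c, W, hα, hβ, hR, hαR, hαν, hcpos, hclim, hW, hpt, hgrad, t, ht, y, hne⟩ :=
    exists_singularZoom_package hν hT hsol hLH hdec hTI x₀ (InviscidTop.sing_of_not_bounded hno)
  have hPc : ∀ w : ℝ, IsClosed {L : E3 →L[ℝ] E3 | w * ‖L e‖ ≤ ε} := fun w =>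
    isClosed_le (continuous_const.mul (continuous_eval_const e).norm) continuous_const
  have hP := StretchedTop.closed_transfer hα hβ hαR hcpos hclim hpt hgrad (P := fun w L => w * ‖L e‖ ≤ ε) hPc
    (fun κ hκ w L => by
      show κ * w * ‖(κ⁻¹ • L) e‖ ≤ ε ↔ w * ‖L e‖ ≤ ε
      rw [_root_.smul_apply, norm_smul, Real.norm_eq_abs,
        abs_of_pos (inv_pos.2 hκ), show κ * w * (κ⁻¹ * ‖L e‖) = w * ‖L e‖ by field_simp])
    hΛ hdef
  have hall := gradCond_everywhere hW (P := fun w L => w * ‖L e‖ ≤ ε) hPc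
    (fun w => by
      show w * ‖(0 : E3 →L[ℝ] E3) e‖ ≤ ε
      simp [hε.le]) hP
  exact hne (hLiou e he W hW (fun s hs y' => hall s hs y') t ht y)

/-- **Criterion row F1qa is EXCLUDED** (in kernel): Type I(`M`) + ε(M)-vorticity axis on the top ⇒ extension. -/
theorem rowF1qa_holds : Row_F1qa := by
  intro M
  obtain ⟨ε, hε, hLiou⟩ := liouville_qa_holds M
  refine ⟨ε, hε, fun ν T hν hT u p hsol hLH hdec hTI htop => ?_⟩
  obtain ⟨Λ, hΛ, e, he, hdef⟩ := htop
  apply hasSmoothExtensionPast_of_forall_exists_parabolicCylinder hν hT hsol hLH hdec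
  intro x₀
  by_contra hno
  obtain ⟨α, β, R, c, W, hα, hβ, hR, hαR, hαν, hcpos, hclim, hW, hpt, hgrad, t, ht, y, hne⟩ :=
    exists_singularZoom_package hν hT hsol hLH hdec hTI x₀ (InviscidTop.sing_of_not_bounded hno)
  have hPc : ∀ w : ℝ, IsClosed {L : E3 →L[ℝ] E3 | w * ‖ColumnarTop.axialDefect e L‖ ≤ ε} := fun w =>
    isClosed_le (continuous_const.mul (ColumnarTop.continuous_axialDefect e).norm) continuous_const
  have hH : ∀ᶠ t' in 𝓝[<] T, ∀ x : E3, Λ t' < ‖u t' x‖ →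
      (T - t') * ‖ColumnarTop.axialDefect e (fderiv ℝ (u t') x)‖ ≤ ε :=
    Filter.Eventually.mono hdef fun t' ht' x hx => by rw [ColumnarTop.axialDefect_fderiv]; exact ht' x hx
  have hP := StretchedTop.closed_transfer hα hβ hαR hcpos hclim hpt hgrad (P := fun w L => w * ‖ColumnarTop.axialDefect e L‖ ≤ ε)
    hPc (fun κ hκ w L => by
      show κ * w * ‖ColumnarTop.axialDefect e (κ⁻¹ • L)‖ ≤ ε ↔ w * ‖ColumnarTop.axialDefect e L‖ ≤ ε
      rw [ColumnarTop.axialDefect_smul, norm_smul, Real.norm_eq_abs, abs_of_pos (inv_pos.2 hκ),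
        show κ * w * (κ⁻¹ * ‖ColumnarTop.axialDefect e L‖) = w * ‖ColumnarTop.axialDefect e L‖ by field_simp])
    hΛ hH
  have hall := gradCond_everywhere hW (P := fun w L => w * ‖ColumnarTop.axialDefect e L‖ ≤ ε) hPc
    (fun w => by
      show w * ‖ColumnarTop.axialDefect e (0 : E3 →L[ℝ] E3)‖ ≤ ε
      rw [ColumnarTop.axialDefect, map_zero, inner_zero_left, zero_smul, sub_zero, norm_zero, mul_zero]
      exact hε.le) hP
  exact hne (hLiou e he W hW (fun s hs y' => by rw [← ColumnarTop.axialDefect_fderiv]; exact hall s hs y') t ht y)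

/-- **Criterion row F1qw is EXCLUDED** (in kernel): Type I(`M`) + ε(M)-sub-Type-I vorticity on the top ⇒
extension. -/
theorem rowF1qw_holds : Row_F1qw := by
  intro M
  obtain ⟨ε, hε, hLiou⟩ := liouville_qw_holds M
  refine ⟨ε, hε, fun ν T hν hT u p hsol hLH hdec hTI htop => ?_⟩
  obtain ⟨Λ, hΛ, hdef⟩ := htop
  apply hasSmoothExtensionPast_of_forall_exists_parabolicCylinder hν hT hsol hLH hdec
  intro x₀
  by_contra hno
  obtain ⟨α, β, R, c, W, hα, hβ, hR, hαR, hαν, hcpos, hclim, hW, hpt, hgrad, t, ht, y, hne⟩ :=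
    exists_singularZoom_package hν hT hsol hLH hdec hTI x₀ (InviscidTop.sing_of_not_bounded hno)
  have hPc : ∀ w : ℝ, IsClosed {L : E3 →L[ℝ] E3 | w * ‖curlCLM L‖ ≤ ε} := fun w =>
    isClosed_le (continuous_const.mul curlCLM.continuous.norm) continuous_const
  have hH : ∀ᶠ t' in 𝓝[<] T, ∀ x : E3, Λ t' < ‖u t' x‖ →
      (T - t') * ‖curlCLM (fderiv ℝ (u t') x)‖ ≤ ε :=
    Filter.Eventually.mono hdef fun t' ht' x hx => by rw [← curl_eq_curlCLM]; exact ht' x hx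
  have hP := StretchedTop.closed_transfer hα hβ hαR hcpos hclim hpt hgrad (P := fun w L => w * ‖curlCLM L‖ ≤ ε)
    hPc (fun κ hκ w L => by
      show κ * w * ‖curlCLM (κ⁻¹ • L)‖ ≤ ε ↔ w * ‖curlCLM L‖ ≤ ε
      rw [map_smul, norm_smul, Real.norm_eq_abs, abs_of_pos (inv_pos.2 hκ),
        show κ * w * (κ⁻¹ * ‖curlCLM L‖) = w * ‖curlCLM L‖ by field_simp])
    hΛ hH
  have hall := gradCond_everywhere hW (P := fun w L => w * ‖curlCLM L‖ ≤ ε) hPc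
    (fun w => by
      show w * ‖curlCLM (0 : E3 →L[ℝ] E3)‖ ≤ ε
      rw [map_zero, norm_zero, mul_zero]; exact hε.le) hP
  exact hne (hLiou W hW (fun s hs y' => by rw [curl_eq_curlCLM]; exact hall s hs y') t ht y)

/-- **Criterion row F1ql is EXCLUDED** (in kernel): Type I(`M`) + ε(M)-Lamb top ⇒ extension. -/
theorem rowF1ql_holds : Row_F1ql := by
  intro M
  obtain ⟨ε, hε, hLiou⟩ := liouville_ql_holds M
  refine ⟨ε, hε, fun ν T hν hT u p hsol hLH hdec hTI htop => ?_⟩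
  obtain ⟨Λ, hΛ, hdef⟩ := htop
  apply hasSmoothExtensionPast_of_forall_exists_parabolicCylinder hν hT hsol hLH hdec
  intro x₀
  by_contra hno
  obtain ⟨α, β, R, c, W, hα, hβ, hR, hαR, hαν, hcpos, hclim, hW, hpt, hgrad, t, ht, y, hne⟩ :=
    exists_singularZoom_package hν hT hsol hLH hdec hTI x₀ (InviscidTop.sing_of_not_bounded hno)
  have hL := lambDefect_transfer hα hβ hαR hαν hcpos hclim hpt hgrad hΛ hdef
  refine hne (hLiou W hW (fun s hs y' => ?_) t ht y)
  by_cases hy : W s y' = 0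
  · rw [hy, ← crossCLM_apply, map_zero, norm_zero, mul_zero]
    exact hε.le
  · exact hL s hs y' hy

/-- **The floor QUANTITATIVELY THREE-DIMENSIONAL TOP holds** (one `ε(M)` for all four defects: the minimum). -/
theorem quantitativelyThreeDTop_holds : QuantitativelyThreeDTop := by
  intro M
  obtain ⟨ε₁, hε₁, h₁⟩ := rowF1qd_holds M
  obtain ⟨ε₂, hε₂, h₂⟩ := rowF1qa_holds M
  obtain ⟨ε₃, hε₃, h₃⟩ := rowF1qw_holds M
  obtain ⟨ε₄, hε₄, h₄⟩ := rowF1ql_holds M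
  refine ⟨min (min ε₁ ε₂) (min ε₃ ε₄), lt_min (lt_min hε₁ hε₂) (lt_min hε₃ hε₄),
    fun ν T hν hT u p hmax hLH hdec hTI Λ hΛ => ⟨fun e he => ⟨fun h => ?_, fun h => ?_⟩, fun h => ?_,
      fun h => ?_⟩⟩
  · exact hmax.2 (h₁ ν T hν hT u p hmax.1 hLH hdec hTI
      ⟨Λ, hΛ, e, he, h.mono ((min_le_left _ _).trans (min_le_left _ _))⟩)
  · exact hmax.2 (h₂ ν T hν hT u p hmax.1 hLH hdec hTI
      ⟨Λ, hΛ, e, he, h.mono ((min_le_left _ _).trans (min_le_right _ _))⟩)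
  · exact hmax.2 (h₃ ν T hν hT u p hmax.1 hLH hdec hTI
      ⟨Λ, hΛ, h.mono ((min_le_right _ _).trans (min_le_left _ _))⟩)
  · exact hmax.2 (h₄ ν T hν hT u p hmax.1 hLH hdec hTI
      ⟨Λ, hΛ, h.mono ((min_le_right _ _).trans (min_le_right _ _))⟩)

/-- **UNIFORM SHEAR ON THE TOP, unfolded** (display, constant levels): ∀ M ∃ ε(M) > 0: in the maximal
Type-I(`M`) Clay frame, for EVERY unit vector `e`, EVERY level `Λ` and every `t₁ < T` some `t ∈ (t₁, T)` has
a `Λ`-fast point with `(T − t) ‖∂_e u(t, x)‖ > ε` — the fast fluid shears at rate `> ε(M)/(T − t)` in every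
direction, arbitrarily close to `T`. -/
theorem uniformShearOnTop_unfolded : ∀ M : ℝ, ∃ ε : ℝ, 0 < ε ∧ ∀ (ν T : ℝ), 0 < ν → 0 < T →
    ∀ (u : ℝ → E3 → E3) (p : ℝ → E3 → ℝ),
    IsMaximalSmoothSolution ν 0 u p T → IsLerayHopfOn T ν 0 (u 0) u →
    HasRapidSpatialDecay (u 0) → IsTypeIBlowupWith M ν u T →
    ∀ e : E3, ‖e‖ = 1 → ∀ Λ : ℝ, ∀ t₁ : ℝ, t₁ < T →
      ∃ t ∈ Ioo t₁ T, ∃ x : E3, Λ < ‖u t x‖ ∧ ε < (T - t) * ‖fderiv ℝ (u t) x e‖ := by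
  intro M
  obtain ⟨ε, hε, hfl⟩ := quantitativelyThreeDTop_holds M
  refine ⟨ε, hε, fun ν T hν hT u p hmax hLH hdec hTI e he Λ t₁ ht₁ => ?_⟩
  by_contra hno
  push Not at hno
  refine ((hfl ν T hν hT u p hmax hLH hdec hTI (fun _ => Λ) (isSubcriticalLevel_const T Λ)).1 e he).1 ?_
  exact eventually_of_mem (Ioo_mem_nhdsLT ht₁) fun t ht x hx => hno t ht x hx

/-- **UNIFORM VORTICITY ON THE TOP, unfolded** (display): ∀ M ∃ ε(M) > 0: for EVERY level `Λ` and every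
`t₁ < T` some `t ∈ (t₁, T)` has a `Λ`-fast point with `(T − t) ‖ω(t, x)‖ > ε`. -/
theorem uniformVorticityOnTop_unfolded : ∀ M : ℝ, ∃ ε : ℝ, 0 < ε ∧ ∀ (ν T : ℝ), 0 < ν → 0 < T →
    ∀ (u : ℝ → E3 → E3) (p : ℝ → E3 → ℝ),
    IsMaximalSmoothSolution ν 0 u p T → IsLerayHopfOn T ν 0 (u 0) u →
    HasRapidSpatialDecay (u 0) → IsTypeIBlowupWith M ν u T →
    ∀ Λ : ℝ, ∀ t₁ : ℝ, t₁ < T →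
      ∃ t ∈ Ioo t₁ T, ∃ x : E3, Λ < ‖u t x‖ ∧ ε < (T - t) * ‖curl (u t) x‖ := by
  intro M
  obtain ⟨ε, hε, hfl⟩ := quantitativelyThreeDTop_holds M
  refine ⟨ε, hε, fun ν T hν hT u p hmax hLH hdec hTI Λ t₁ ht₁ => ?_⟩
  by_contra hno
  push Not at hno
  refine (hfl ν T hν hT u p hmax hLH hdec hTI (fun _ => Λ) (isSubcriticalLevel_const T Λ)).2.1 ?_
  exact eventually_of_mem (Ioo_mem_nhdsLT ht₁) fun t ht x hx => hno t ht x hx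

/-- **UNIFORM LAMB VECTOR ON THE TOP, unfolded** (display): ∀ M ∃ ε(M) > 0: for EVERY level `Λ` and every
`t₁ < T` some `t ∈ (t₁, T)` has a `Λ`-fast point with `(T − t)^{3/2} ‖ω × u‖ > ε √ν`. -/
theorem uniformLambOnTop_unfolded : ∀ M : ℝ, ∃ ε : ℝ, 0 < ε ∧ ∀ (ν T : ℝ), 0 < ν → 0 < T →
    ∀ (u : ℝ → E3 → E3) (p : ℝ → E3 → ℝ),
    IsMaximalSmoothSolution ν 0 u p T → IsLerayHopfOn T ν 0 (u 0) u →
    HasRapidSpatialDecay (u 0) → IsTypeIBlowupWith M ν u T →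
    ∀ Λ : ℝ, ∀ t₁ : ℝ, t₁ < T →
      ∃ t ∈ Ioo t₁ T, ∃ x : E3, Λ < ‖u t x‖ ∧
        ε * Real.sqrt ν < (T - t) * Real.sqrt (T - t) * ‖cross (curl (u t) x) (u t x)‖ := by
  intro M
  obtain ⟨ε, hε, hfl⟩ := quantitativelyThreeDTop_holds M
  refine ⟨ε, hε, fun ν T hν hT u p hmax hLH hdec hTI Λ t₁ ht₁ => ?_⟩
  by_contra hno
  push Not at hno
  refine (hfl ν T hν hT u p hmax hLH hdec hTI (fun _ => Λ) (isSubcriticalLevel_const T Λ)).2.2 ?_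
  exact eventually_of_mem (Ioo_mem_nhdsLT ht₁) fun t ht x hx => hno t ht x hx

/-- F1qw holds also as a corollary of F1qa (lattice check). -/
theorem rowF1qw_holds' : Row_F1qw := rowF1qw_of_rowF1qa rowF1qa_holds

/-- The residual is EXACTLY row F1 (declared; no movement on `Row_F1` is claimed). -/
theorem vorticityDefectSlack_iff_rowF1 : VorticityDefectSlack ↔ ScenarioCensus.Row_F1 :=
  ⟨rowF1_of rowF1qw_holds, vorticityDefectSlack_of_rowF1⟩

/-- Deciding direction used by the split. -/
theorem rowF1_of_vorticityDefectSlack : VorticityDefectSlack → ScenarioCensus.Row_F1 :=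
  rowF1_of rowF1qw_holds

end Summit.NavierStokesRegularity.NavierStokesRegularity.Theorems.ScenarioCensus.EpsilonTop

namespace Summit.NavierStokesRegularity.NavierStokesRegularity.Theorems.ScenarioCensus

/-! ## Census KEYS (ns `…Theorems.ScenarioCensus`): the ε-TOP family of row F1 — TREE-decided members F1qd / F1qa / F1qw / F1ql -/

/-- **Cell F1qd** (row F1 frame VERBATIM + Type I(`M`) + ε(M)-columnar top `(T−t)‖∂_e u‖ ≤ ε(M)` on the top of one subcritical level ⇒ smooth extension past `T`): `:= EpsilonTop.Row_F1qd`. DECIDED. -/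
def Row_F1qd : Prop := EpsilonTop.Row_F1qd
/-- F1qd is EXCLUDED (decided in the tree): `EpsilonTop.rowF1qd_holds`. -/
theorem row_F1qd_excluded : Row_F1qd := EpsilonTop.rowF1qd_holds

/-- **Cell F1qa** (ε(M)-vorticity axis on the top): `:= EpsilonTop.Row_F1qa`. DECIDED. -/
def Row_F1qa : Prop := EpsilonTop.Row_F1qa
/-- F1qa is EXCLUDED (decided in the tree): `EpsilonTop.rowF1qa_holds`. -/
theorem row_F1qa_excluded : Row_F1qa := EpsilonTop.rowF1qa_holds

/-- **Cell F1qw** (ε(M)-sub-Type-I vorticity on the top): `:= EpsilonTop.Row_F1qw`. DECIDED. -/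
def Row_F1qw : Prop := EpsilonTop.Row_F1qw
/-- F1qw is EXCLUDED (decided in the tree): `EpsilonTop.rowF1qw_holds`. -/
theorem row_F1qw_excluded : Row_F1qw := EpsilonTop.rowF1qw_holds

/-- **Cell F1ql** (ε(M)-Lamb top): `:= EpsilonTop.Row_F1ql`. DECIDED. -/
def Row_F1ql : Prop := EpsilonTop.Row_F1ql
/-- F1ql is EXCLUDED (decided in the tree): `EpsilonTop.rowF1ql_holds`. -/
theorem row_F1ql_excluded : Row_F1ql := EpsilonTop.rowF1ql_holds

/-- **Floor QUANTITATIVELY THREE-DIMENSIONAL TOP** at the level of the census keys: `EpsilonTop.quantitativelyThreeDTop_holds`. -/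
theorem row_F1_quantitativelyThreeDTop : EpsilonTop.QuantitativelyThreeDTop := EpsilonTop.quantitativelyThreeDTop_holds

end Summit.NavierStokesRegularity.NavierStokesRegularity.Theorems.ScenarioCensus

end
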